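import Mathlib.Topology.Algebra.Polynomial
import Mathlib.MeasureTheory.Integral.IntegrableOn
import Literature.NumberTheory.Transcendental.KZLogCalculusProofs
import Literature.NumberTheory.Transcendental.KZBallPeelingAux

/-!
# `NormalFormPrinciple` (stmt-KontsevichZagierPeriods-3869), registered stub
# `slab_sub_pt_mem_relations` — a second, dependency-light proof along the Mathlib measure API

Pure proof file (`--supports` the crux; siege variant "Mathlib API route"). It proves, by name and
with the registered signature, the Newton–Leibniz move over the point for an interval
representation with a `ℚ`-rational primitive:

  `N = [(α,β), f]`, `F = P_F/Q_F` (`P_F, Q_F ∈ ℚ[X]`, `Q_F ≠ 0` on `[α,β]`), `F' = f` on `(α,β)`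
  `⟹ [N] − [pt, F(β) − F(α)] ∈ KZ.relations`.

The certificate is the shortest possible chain of Kontsevich–Zagier moves:

* ONE Newton–Leibniz move (rule 3) over the base `ℝ⁰`, band `[[α,β], f]`, primitive `z ↦ F(z₀)`;
* ONE domain-additivity move (rule 1a) `[[α,β], f] = [N] + [rim, f]`, the rim being the two-point
  set `{x₀ ∈ [α,β] ∖ (α,β)}`, which is Lebesgue-null, so `[rim, f]` is junk
  (`KZ.of_mem_relations_of_volume_eq_zero`).

All measure theory is transported from `ℝ` along Mathlib's volume-preserving
`MeasurableEquiv.funUnique (Fin 1) ℝ` (`MeasurePreserving.measure_preimage`,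
`MeasurePreserving.integrableOn_comp_preimage`, `integrableOn_Icc_iff_integrableOn_Ioo`,
`Set.Icc_sdiff_Ioo_same`, `Set.Finite.measure_zero`); no problem-side (`Summits.*`) file is imported.

Sources: M. Kontsevich, D. Zagier, *Periods* (2001), §1.2 rules (1), (3). No definitions.
-/

noncomputable section

open MeasureTheory Set
open scoped Polynomial
open Literature.NumberTheory.Transcendental Literature.NumberTheory.Transcendental.KZ
open Literature.ModelTheory.ExponentialFields (IsSemialgebraic isSemialgebraic_univ
  isSemialgebraic_setOf_eval_le)
open Literature.NumberTheory.Transcendental.KZ.BallPeeling (isSemialgebraic_Ioo₁)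

namespace Summit.KontsevichZagierPeriods.HurwitzMicroSectors.NormalFormPrinciple.PiBox.SlabMathlib

/-- **Newton–Leibniz over the point** (rule 3, plus the null rim, rule 1a). Let `α ≤ β` be
rational, `N = [(α,β), f]` an interval representation whose integrand `x ↦ f(x₀)` is
`ℚ`-semialgebraic on the closed slab, and `F = P_F/Q_F` (`P_F, Q_F ∈ ℚ[X]`, `Q_F ≠ 0` on `[α,β]`) a
primitive of `f` on `(α,β)`. Then `[N] − [pt, F(β) − F(α)] ∈ relations` for every point
representation `Z` over `ℝ⁰` with that constant. Move chain: one Newton–Leibniz move from the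
closed slab to the point, one domain-additivity move splitting the closed slab into `N` and the
null two-point rim, and the junk rim. [cite: KontsevichZagier2001, §1.2 rule (3)] -/
theorem slab_sub_pt_mem_relations {α β : ℚ} (hαβ : α ≤ β) (f : ℝ → ℝ) (PF QF : ℚ[X])
    (hQF : ∀ t ∈ Set.Icc (α:ℝ) β, (Polynomial.aeval t QF : ℝ) ≠ 0)
    (hderiv : ∀ t ∈ Set.Ioo (α:ℝ) β,
      HasDerivAt (fun u : ℝ => (Polynomial.aeval u PF : ℝ) / Polynomial.aeval u QF) (f t) t)
    (hf : IsSemialgebraicFunOn ℚ {x : Fin 1 → ℝ | x 0 ∈ Set.Icc (α:ℝ) β} (fun x => f (x 0)))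
    (N : IntegralRep 1) (hNd : N.domain = {x | x 0 ∈ Set.Ioo (α:ℝ) β})
    (hNi : EqOn N.integrand (fun x => f (x 0)) N.domain)
    (Z : IntegralRep 0) (hZd : Z.domain = univ)
    (hZi : Z.integrand = fun _ => (Polynomial.aeval (β:ℝ) PF : ℝ) / Polynomial.aeval (β:ℝ) QF -
      (Polynomial.aeval (α:ℝ) PF : ℝ) / Polynomial.aeval (α:ℝ) QF) :
    of N - of Z ∈ relations := by
  have hαβ' : (α:ℝ) ≤ β := by exact_mod_cast hαβ
  -- (0) Mathlib transport `ℝ¹ ≃ᵐ ℝ` along the first coordinate (`MeasurableEquiv.funUnique`)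
  have hmp : MeasurePreserving (MeasurableEquiv.funUnique (Fin 1) ℝ) volume volume :=
    volume_preserving_funUnique (Fin 1) ℝ
  have hvol : ∀ {S : Set ℝ}, MeasurableSet S → volume {x : Fin 1 → ℝ | x 0 ∈ S} = volume S :=
    fun hS => hmp.measure_preimage hS.nullMeasurableSet
  have hint : ∀ {S : Set ℝ},
      IntegrableOn (fun x : Fin 1 → ℝ => f (x 0)) {x | x 0 ∈ S} ↔ IntegrableOn f S :=
    hmp.integrableOn_comp_preimage (MeasurableEquiv.funUnique (Fin 1) ℝ).measurableEmbedding
  -- (1) the closed slab `C`, the open slab `O = N.domain`, the two-point rim `C ∖ O`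
  have hCsa : IsSemialgebraic ℚ {x : Fin 1 → ℝ | x 0 ∈ Set.Icc (α:ℝ) β} := by
    have h1 := isSemialgebraic_setOf_eval_le (k := ℚ) (R := ℝ)
      (MvPolynomial.C α : MvPolynomial (Fin 1) ℚ) (MvPolynomial.X 0)
    have h2 := isSemialgebraic_setOf_eval_le (k := ℚ) (R := ℝ)
      (MvPolynomial.X 0 : MvPolynomial (Fin 1) ℚ) (MvPolynomial.C β)
    simp only [MvPolynomial.aeval_X, MvPolynomial.aeval_C, eq_ratCast] at h1 h2
    have hset : {x : Fin 1 → ℝ | x 0 ∈ Set.Icc (α:ℝ) β} =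
        {x : Fin 1 → ℝ | (α:ℝ) ≤ x 0} ∩ {x | x 0 ≤ (β:ℝ)} := by
      ext x
      simp
    rw [hset]
    exact h1.inter h2
  have hOsa : IsSemialgebraic ℚ {x : Fin 1 → ℝ | x 0 ∈ Set.Ioo (α:ℝ) β} := isSemialgebraic_Ioo₁ α β
  have hEsa : IsSemialgebraic ℚ {x : Fin 1 → ℝ | x 0 ∈ Set.Icc (α:ℝ) β \ Set.Ioo (α:ℝ) β} :=
    hCsa.diff hOsa
  have hE0 : volume {x : Fin 1 → ℝ | x 0 ∈ Set.Icc (α:ℝ) β \ Set.Ioo (α:ℝ) β} = 0 := by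
    rw [hvol (measurableSet_Icc.diff measurableSet_Ioo), Icc_sdiff_Ioo_same hαβ']
    exact ((Set.finite_singleton _).insert _).measure_zero _
  -- (2) integrability of `x ↦ f (x 0)` on the closed slab, read off `N` through `ℝ`
  have hfiO : IntegrableOn (fun x : Fin 1 → ℝ => f (x 0)) {x | x 0 ∈ Set.Ioo (α:ℝ) β} := by
    have h := N.integrableOn.congr_fun hNi (IntegralRep.measurableSet_domain_holds N)
    rwa [hNd] at h
  have hfiC : IntegrableOn (fun x : Fin 1 → ℝ => f (x 0)) {x | x 0 ∈ Set.Icc (α:ℝ) β} := by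
    rw [hint, integrableOn_Icc_iff_integrableOn_Ioo]
    exact hint.1 hfiO
  -- (3) the closed-slab representation `R = [[α,β], f]` and the rim representation `E`
  obtain ⟨R, hRd, hRi⟩ : ∃ R : IntegralRep 1,
      R.domain = {x | x 0 ∈ Set.Icc (α:ℝ) β} ∧ R.integrand = fun x => f (x 0) :=
    ⟨⟨_, _, hCsa, hf, hfiC⟩, rfl, rfl⟩
  obtain ⟨E, hEd, hEi⟩ : ∃ E : IntegralRep 1,
      E.domain = {x | x 0 ∈ Set.Icc (α:ℝ) β \ Set.Ioo (α:ℝ) β} ∧ E.integrand = fun x => f (x 0) :=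
    ⟨⟨_, _, hEsa, hf.mono (fun x hx => hx.1) hEsa, hfiC.mono_set fun x hx => hx.1⟩, rfl, rfl⟩
  -- (4) ONE Newton–Leibniz move over the point `ℝ⁰`, primitive `z ↦ P_F(z₀)/Q_F(z₀)`
  have hs0 : ∀ (x : Fin 0 → ℝ) (t : ℝ), (Fin.snoc x t : Fin 1 → ℝ) 0 = t := fun _ _ => rfl
  have hX : ∀ (x : Fin 1 → ℝ) (A : ℚ[X]), MvPolynomial.aeval x
      (Polynomial.aeval (MvPolynomial.X 0 : MvPolynomial (Fin 1) ℚ) A) =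
        (Polynomial.aeval (x 0) A : ℝ) := fun x A => by
    rw [← Polynomial.aeval_algHom_apply, MvPolynomial.aeval_X]
  have hNL : of R - of Z ∈ newtonLeibnizRel := by
    refine ⟨0, R, Z, fun _ => (α:ℝ), fun _ => (β:ℝ),
      fun z => (Polynomial.aeval (z 0) PF : ℝ) / Polynomial.aeval (z 0) QF,
      ?_, ?_, ?_, fun _ _ => hαβ', ?_, ?_, ?_, ?_, rfl⟩
    · -- the primitive is a quotient of `ℚ`-polynomials in `x 0` on the closed slab
      rw [hRd]
      refine (isSemialgebraicFunOn_aeval_div_aeval hCsa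
        (Polynomial.aeval (MvPolynomial.X 0 : MvPolynomial (Fin 1) ℚ) PF)
        (Polynomial.aeval (MvPolynomial.X 0 : MvPolynomial (Fin 1) ℚ) QF) fun x hx => ?_).congr
        fun x _ => ?_
      · rw [hX]
        exact hQF (x 0) hx
      · simp only [hX]
    · rw [hZd]
      exact isSemialgebraicFunOn_ratCast isSemialgebraic_univ α
    · rw [hZd]
      exact isSemialgebraicFunOn_ratCast isSemialgebraic_univ β
    · -- the closed slab is the band over the point with the constant edges `α ≤ β`
      rw [hRd, hZd]
      ext z
      simp only [mem_setOf_eq, mem_Icc, mem_univ, true_and, Fin.last_zero]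
    · -- continuity of the primitive on the closed fibre
      intro x _
      simp only [hs0]
      exact (Polynomial.continuous_aeval PF).continuousOn.div
        (Polynomial.continuous_aeval QF).continuousOn hQF
    · -- its derivative on the open fibre is the integrand
      intro x _ t ht
      rw [hRi]
      simp only [hs0]
      exact hderiv t ht
    · -- the value at the point is `F(β) − F(α)`
      intro x _
      rw [hZi]
      simp only [hs0]
  -- (5) ONE domain-additivity move `[R] = [N] + [E]`; `[E]` is junk (null domain)
  have hDA : of R - of N - of E ∈ domainAddRel := by
    refine ⟨1, R, N, E, ?_, ?_, fun x hx => ?_, fun _ _ => ?_, rfl⟩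
    · rw [hRd, hNd, hEd]
      ext x
      simp only [mem_setOf_eq, mem_union, mem_sdiff]
      refine ⟨fun hx => ?_, fun hx => hx.elim (fun h => Ioo_subset_Icc_self h) fun h => h.1⟩
      by_cases h : x 0 ∈ Set.Ioo (α:ℝ) β
      · exact Or.inl h
      · exact Or.inr ⟨hx, h⟩
    · rw [hNd, hEd]
      exact measure_mono_null (fun x hx => (hx.2.2 hx.1).elim) measure_empty
    · rw [hRi]
      exact (hNi hx).symm
    · rw [hRi, hEi]
  have hE : of E ∈ relations := of_mem_relations_of_volume_eq_zero E (by rw [hEd]; exact hE0)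
  have key : of N - of Z = (of R - of Z) - (of R - of N - of E) - of E := by abel
  rw [key]
  exact relations.sub_mem (relations.sub_mem (newtonLeibnizRel_subset_relations hNL)
    (domainAddRel_subset_relations hDA)) hE

end Summit.KontsevichZagierPeriods.HurwitzMicroSectors.NormalFormPrinciple.PiBox.SlabMathlib
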